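import Literature.NumberTheory.EllipticCurves.KubertTateFiveMuDescent
import Mathlib.NumberTheory.NumberField.Basic
import HarnessLib

/-!
# The `μ₅`-side of the `5`-descent on the Kubert–Tate family `E_{m,n}` over a NUMBER FIELD `K`, I:
# the local condition of `Sel^ψ(E'/K)` at a `K`-field `L`, read in `Lˣ/Lˣ⁵`

PROOF-ONLY file (theorems only, no definition, no named fact, no `sorry`), topic
`NumberTheory/EllipticCurves`.  This is the base-field-generic form of §0–§1 of the tree's
`KubertTateFiveMuDescent` (there `K = ℚ`): `E = E_{m,n} = kubertTateFive m n` over a number field `K`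
(`m, n ∈ ℤ`, `E` elliptic), `T = (0,0)` of order `5`, `φ : E → E' = E/⟨T⟩` Vélu's isogeny
(`KubertTateVelu.fiveIsogeny`, defined over any field of characteristic `0`), `ψ : E' → E` any isogeny with
`ψ ∘ φ = [5]`, and a `Γ_K`-fixed reference point `P₁ ∈ E(K̄)` with `25 P₁ ≠ O`.

* §0 `exists_dual`, `comp_dual_eq`, `equation_iff_base`, `exists_five_zsmul_eq` (`5P₁ = (x₀, y₀)` with
  `x₀, y₀ ∈ K`, `≠ T`).
* §1 **`kummer_local`** — for a `K`-field `L` (e.g. a completion `K_v`), a cocycle `c : Γ_K → ker ψ` whose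
  class dies in `H¹(L, E')` and a Kummer generator `(α, a)` of `c` (`α⁵ = a ∈ Kˣ`, `χ(c σ) = σα/α`): for
  some `k` with `5 ∤ k` and `u ∈ Lˣ`, either `(ιa)ᵏ = u⁵`, or `(ιa)ᵏ · u⁵ · ι f_T(x₀, y₀) = f_T(x, y)` at an
  `L`-rational affine point `(x, y) ≠ T` of `E`, where `f_T = xy − nx² + n²y` is the Kummer function
  (`div f_T = 5(T) − 5(O)`; tree `KubertTateKummer.kummerFn`, generic over the field).

The proofs are those of the `ℚ`-file verbatim (the generic inputs `IsogenyDualKernelMuCharacter`,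
`…KummerDescent`, `…LocalKummer` are stated over an arbitrary base field); the sequel
`KubertTateFiveMuDescentNumberFieldValuation` reads the condition at the finite places of `K` and, for
`K = ℚ(i)`, bounds `#Sel^ψ(E'/ℚ(i))` by `5^{#{𝔭 ∣ mn}}` — the `μ₅`-side of the `5`-descent over `ℚ(i)`
whose `ℤ/5`-side is `KubertTateFiveSelmerTameGaussian`.

## References

* [SilvermanAEC2009] J. H. Silverman, *AEC*, 2nd ed., Thm. X.4.2, Prop. X.4.9, Exercise 10.1(c), Thm. X.1.1.
* [Fisher2001FiveSevenDescent] T. Fisher, JEMS 3 (2001), §§1–2 (`5`-descent on curves with a `5`-torsion point).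
* [Kubert1976] D. S. Kubert, *Universal bounds on the torsion of elliptic curves*, Table 3 (`N = 5`).
-/

noncomputable section

open scoped Classical NNReal NumberField AddSubgroup
open WeierstrassCurve WeierstrassCurve.Isogeny Field IsDedekindDomain
open Literature.NumberTheory.EllipticCurves Literature.NumberTheory.EllipticCurves.KubertTateKummer
  Literature.NumberTheory.EllipticCurves.KubertTateVelu Literature.NumberTheory.GaloisRepresentations
  Literature.NumberTheory.EllipticCurves.WeierstrassFunctionField

namespace Literature.NumberTheory.EllipticCurves

namespace KubertTateMuDescentNF

/-! ## §0 The data: `E_{m,n}`, the dual pair `(φ, ψ)`, `T̄`, a reference point `P₁` -/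

variable {K : Type} [Field K] [CharZero K]
variable (m n : ℤ) [hE : (kubertTateFive (m : K) (n : K)).IsElliptic]
variable (ψ : Isogeny (kubertTateFive' (m : K) (n : K)) (kubertTateFive (m : K) (n : K)))
  (hψ : ∀ P, ψ (fiveIsogeny (m : K) (n : K) P) = ((5 : ℕ) : ℤ) • P)

/-- **The dual exists**: an isogeny `ψ : E' → E` with `ψ ∘ φ = [5]` (Silverman III.6.1, tree
`Isogeny.exists_dual_of_isElliptic`; `deg φ = #ker φ = 5`). [cite: SilvermanAEC2009, Thm. III.6.1(a)] -/
theorem exists_dual : ∃ ψ : Isogeny (kubertTateFive' (m : K) (n : K)) (kubertTateFive (m : K) (n : K)),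
    ∀ P, ψ (fiveIsogeny (m : K) (n : K) P) = ((5 : ℕ) : ℤ) • P := by
  obtain ⟨ψ, hψ⟩ := (fiveIsogeny (m : K) (n : K)).exists_dual_of_isElliptic
  refine ⟨ψ, fun P ↦ ?_⟩
  rw [hψ, Isogeny.degree, natCard_ker_fiveIsogeny]

include hψ in
/-- `φ ∘ ψ = [5]` on `E'(K̄)` (`φ` is onto `E'(K̄)`). [cite: SilvermanAEC2009, Thm. III.6.2(a)] -/
theorem comp_dual_eq (Q : geomPoints (kubertTateFive' (m : K) (n : K))) :
    fiveIsogeny (m : K) (n : K) (ψ Q) = ((5 : ℕ) : ℤ) • Q := by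
  obtain ⟨P, rfl⟩ := (fiveIsogeny (m : K) (n : K)).surjective Q
  rw [hψ, map_zsmul]

/-- Two affine points with equal coordinates are equal (proof-irrelevant form). [folklore] -/
private theorem some_eq_some_of_eq {R : Type*} [CommRing R] {V : WeierstrassCurve R}
    {x y x' y' : R} (hx : x = x') (hy : y = y') (h : V.toAffine.Nonsingular x y)
    (h' : V.toAffine.Nonsingular x' y') : Affine.Point.some x y h = Affine.Point.some x' y' h' := by
  subst hx hy; rfl

variable (P₁ : geomPoints (kubertTateFive (m : K) (n : K)))
  (hP₁ : ∀ σ : absoluteGaloisGroup K, σ • P₁ = P₁) (h25 : ((25 : ℕ) : ℤ) • P₁ ≠ 0)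

omit hE [CharZero K] in
/-- The Weierstrass equation of `E` over `K` in the Kubert–Tate shape. [cite: Kubert1976, Table 3 (N = 5)] -/
theorem equation_iff_base (x y : K) :
    (kubertTateFive (m : K) (n : K)).toAffine.Equation x y ↔
      y ^ 2 + ((n : K) - m) * x * y - m * (n : K) ^ 2 * y = x ^ 3 - m * n * x ^ 2 := by
  rw [Affine.equation_iff]
  simp only [kubertTateFive]
  constructor <;> intro h <;> linear_combination h

include hP₁ h25 in
/-- `5P₁` is an affine point `(x₀, y₀) ≠ T = (0, 0)` with rational coordinates (Galois descent for the fixed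
point `5P₁`; `25 P₁ ≠ O` and `5T = O`). [cite: SilvermanAEC2009, VIII.§1] -/
theorem exists_five_zsmul_eq : ∃ (x₀ y₀ : K)
    (h₀' : ((kubertTateFive (m : K) (n : K)).baseChange (AlgebraicClosure K)).toAffine.Nonsingular
      (algebraMap K (AlgebraicClosure K) x₀) (algebraMap K (AlgebraicClosure K) y₀)),
    ((5 : ℕ) : ℤ) • P₁ = .some _ _ h₀' ∧ ¬ (x₀ = 0 ∧ y₀ = 0) ∧
      y₀ ^ 2 + ((n : K) - m) * x₀ * y₀ - m * (n : K) ^ 2 * y₀ = x₀ ^ 3 - m * n * x₀ ^ 2 := by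
  have hfix : ∀ σ : absoluteGaloisGroup K, σ • (((5 : ℕ) : ℤ) • P₁) = ((5 : ℕ) : ℤ) • P₁ := fun σ ↦ by
    rw [smul_comm, hP₁]
  have h55 : ((25 : ℕ) : ℤ) • P₁ = ((5 : ℕ) : ℤ) • (((5 : ℕ) : ℤ) • P₁) := by
    rw [← mul_zsmul]; norm_num
  obtain ⟨R, hR⟩ := exists_toGeomPoints_eq_of_forall_smul_eq (W := kubertTateFive (m : K) (n : K)) hfix
  rcases R with _ | ⟨x₀, y₀, h₀⟩
  · exfalso
    apply h25
    rw [h55, ← hR]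
    exact (zsmul_zero _ : ((5 : ℕ) : ℤ) • (0 : geomPoints (kubertTateFive (m : K) (n : K))) = 0)
  · obtain ⟨h₀', e⟩ : ∃ h', toGeomPoints (kubertTateFive (m : K) (n : K)) (.some x₀ y₀ h₀) =
        .some (algebraMap K (AlgebraicClosure K) x₀) (algebraMap K (AlgebraicClosure K) y₀) h' :=
      ⟨_, Affine.Point.map_some (W' := (kubertTateFive (m : K) (n : K)).toAffine)
        (Algebra.ofId K (AlgebraicClosure K)) h₀⟩
    refine ⟨x₀, y₀, h₀', hR.symm.trans e, ?_, (equation_iff_base m n x₀ y₀).mp h₀.left⟩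
    rintro ⟨rfl, rfl⟩
    apply h25
    rw [h55, ← hR, e, ← Tbar_eq_some]
    exact five_zsmul_Tbar (m : K) (n : K)
  where
  /-- `T̄ = (ι 0, ι 0)`. -/
  Tbar_eq_some (h' : ((kubertTateFive (m : K) (n : K)).baseChange (AlgebraicClosure K)).toAffine.Nonsingular
      (algebraMap K (AlgebraicClosure K) 0) (algebraMap K (AlgebraicClosure K) 0)) :
      Tbar (m : K) (n : K) = .some _ _ h' := by
    rw [Tbar_eq]; exact some_eq_some_of_eq (map_zero _).symm (map_zero _).symm _ _

/-! ## §1 The local condition at a `K`-field `L`, read in `Lˣ/Lˣ⁵` -/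

section Local

variable (L : Type) [Field L] [Algebra K L] [CharZero L]

omit [Algebra K L] [CharZero L] in
/-- Transport of Kummer-function data along an equality of Weierstrass curves (both sides variables;
`subst`). [folklore] -/
private theorem kummerData_transport {V V' : WeierstrassCurve L} [V.IsElliptic] [V'.IsElliptic] (e : V = V') (n' : L)
    (h0' : (V'.baseChange (AlgebraicClosure L)).toAffine.Nonsingular 0 0)
    (hf : ∃ f : V'.geomFunctionField, f ≠ 0 ∧
      (∀ Q : geomPoints V', ord (V'.baseChange (AlgebraicClosure L)).toAffine Q f =
        ((5 : ℕ) : ℤ) * ((if Q = Affine.Point.some 0 0 h0' then 1 else 0) - (if Q = 0 then 1 else 0))) ∧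
      (∀ (x y : AlgebraicClosure L) (h : (V'.baseChange (AlgebraicClosure L)).toAffine.Nonsingular x y),
        V'.HasValueAt f (Affine.Point.some x y h)
          (x * y - algebraMap L (AlgebraicClosure L) n' * x ^ 2 + algebraMap L (AlgebraicClosure L) n' ^ 2 * y)))
    (h0 : (V.baseChange (AlgebraicClosure L)).toAffine.Nonsingular 0 0) :
    ∃ f : V.geomFunctionField, f ≠ 0 ∧
      (∀ Q : geomPoints V, ord (V.baseChange (AlgebraicClosure L)).toAffine Q f =
        ((5 : ℕ) : ℤ) * ((if Q = Affine.Point.some 0 0 h0 then 1 else 0) - (if Q = 0 then 1 else 0))) ∧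
      (∀ (x y : AlgebraicClosure L) (h : (V.baseChange (AlgebraicClosure L)).toAffine.Nonsingular x y),
        V.HasValueAt f (Affine.Point.some x y h)
          (x * y - algebraMap L (AlgebraicClosure L) n' * x ^ 2 + algebraMap L (AlgebraicClosure L) n' ^ 2 * y)) := by
  subst e
  exact hf

omit hE [CharZero L] [CharZero K] in
/-- `E_{m,n} ⊗ L = E_{m,n}/L` (the family is stable under base change, tree `map_kubertTateFive`).
[cite: Kubert1976, Table 3 (N = 5)] -/
theorem baseChange_eq : (kubertTateFive (m : K) (n : K)).baseChange L = kubertTateFive (m : L) (n : L) := by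
  rw [show (kubertTateFive (m : K) (n : K)).baseChange L = (kubertTateFive (m : K) (n : K)).map (algebraMap K L)
    from rfl, map_kubertTateFive, map_intCast, map_intCast]

omit hE [CharZero L] [CharZero K] in
/-- `ι_*` of a point of `E(K̄)` with `K`-rational coordinates is the point of `E_L(L̄)` with the same coordinates.
[cite: SilvermanAEC2009, VIII.§1] -/
theorem baseExt_some_algebraMap {x y : K}
    (h₁ : ((kubertTateFive (m : K) (n : K)).baseChange (AlgebraicClosure K)).toAffine.Nonsingular
      (algebraMap K (AlgebraicClosure K) x) (algebraMap K (AlgebraicClosure K) y)) :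
    ∃ h', baseExt (kubertTateFive (m : K) (n : K)) L (.some _ _ h₁) =
      .some (algebraMap K (AlgebraicClosure L) x) (algebraMap K (AlgebraicClosure L) y) h' := by
  obtain ⟨h₂, e₂⟩ := Isogeny.localPointsEquivGeomPoints_pointsMap_some L (kubertTateFive (m : K) (n : K)) h₁
  rw [baseExt_apply, e₂]
  have hx : closureEmb (K := K) L (algebraMap K (AlgebraicClosure K) x) = algebraMap K (AlgebraicClosure L) x :=
    (closureEmb (K := K) L).commutes x
  have hy : closureEmb (K := K) L (algebraMap K (AlgebraicClosure K) y) = algebraMap K (AlgebraicClosure L) y :=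
    (closureEmb (K := K) L).commutes y
  exact ⟨by rw [← hx, ← hy]; exact h₂, some_eq_some_of_eq hx hy _ _⟩

omit [CharZero L] [CharZero K] in
/-- `T_L = ι_* T̄ = (0, 0)` in `E_L(L̄)`. [cite: Kubert1976, Table 3 (N = 5)] -/
theorem baseExt_Tbar : ∃ h', baseExt (kubertTateFive (m : K) (n : K)) L (Tbar (m : K) (n : K)) = .some 0 0 h' := by
  obtain ⟨h₂, e₂⟩ := Isogeny.localPointsEquivGeomPoints_pointsMap_some L (kubertTateFive (m : K) (n : K))
    (KubertTateKummer.nonsingular_zero_zero (m : K) (n : K))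
  rw [Tbar_eq, baseExt_apply, e₂]
  have h0 : closureEmb (K := K) L (0 : AlgebraicClosure K) = 0 := map_zero _
  exact ⟨by rw [← h0]; exact h₂, some_eq_some_of_eq h0 h0 _ _⟩

omit [CharZero L] [CharZero K] in
/-- **A Kummer function `f_T` on `E_L` with `div f_T = 5(T_L) − 5(O)` and values `f_T(x, y) = xy − nx² + n²y`**
(the tree's `KubertTateKummer.kummerFn m n` over `L`, transported along `E ⊗ L = E_{m,n}/L`).
[cite: SilvermanAEC2009, Exercise 10.1(c)] -/
theorem exists_kummerFn (h0 : (((kubertTateFive (m : K) (n : K)).baseChange L).baseChange (AlgebraicClosure L)).toAffine.Nonsingular 0 0) :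
    ∃ f : ((kubertTateFive (m : K) (n : K)).baseChange L).geomFunctionField, f ≠ 0 ∧
      (∀ Q : geomPoints ((kubertTateFive (m : K) (n : K)).baseChange L),
        ord (((kubertTateFive (m : K) (n : K)).baseChange L).baseChange (AlgebraicClosure L)).toAffine Q f =
        ((5 : ℕ) : ℤ) * ((if Q = Affine.Point.some 0 0 h0 then 1 else 0) - (if Q = 0 then 1 else 0))) ∧
      (∀ (x y : AlgebraicClosure L) (h : (((kubertTateFive (m : K) (n : K)).baseChange L).baseChange
          (AlgebraicClosure L)).toAffine.Nonsingular x y),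
        ((kubertTateFive (m : K) (n : K)).baseChange L).HasValueAt f (Affine.Point.some x y h)
          (x * y - algebraMap L (AlgebraicClosure L) (n : L) * x ^ 2 + algebraMap L (AlgebraicClosure L) (n : L) ^ 2 * y)) := by
  haveI : (kubertTateFive (m : L) (n : L)).IsElliptic :=
    baseChange_eq (K := K) m n L ▸ isElliptic_baseChange (kubertTateFive (m : K) (n : K)) L
  refine kummerData_transport L (baseChange_eq (K := K) m n L) (n : L) (KubertTateKummer.nonsingular_zero_zero (m : L) (n : L))
    ⟨kummerFn (m : L) (n : L), kummerFn_ne_zero (m : L) (n : L), fun Q ↦ ?_,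
      fun x y h ↦ hasValueAt_kummerFn (m : L) (n : L) h⟩ h0
  rw [ord_kummerFn (m : L) (n : L) Q, Tbar_eq]

omit hE [CharZero K] in
/-- A `Γ_L`-fixed point of `E_L(L̄)` off `O` is `(x, y)` with `x, y ∈ L`. [cite: SilvermanAEC2009, VIII.§1] -/
theorem exists_eq_some_of_fixed {P : geomPoints ((kubertTateFive (m : K) (n : K)).baseChange L)}
    (hfix : ∀ τ : absoluteGaloisGroup L, τ • P = P) (hP0 : P ≠ 0) :
    ∃ (x y : L) (_ : ((kubertTateFive (m : K) (n : K)).baseChange L).toAffine.Nonsingular x y)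
      (h' : (((kubertTateFive (m : K) (n : K)).baseChange L).baseChange (AlgebraicClosure L)).toAffine.Nonsingular
        (algebraMap L (AlgebraicClosure L) x) (algebraMap L (AlgebraicClosure L) y)),
      P = Affine.Point.some (algebraMap L (AlgebraicClosure L) x) (algebraMap L (AlgebraicClosure L) y) h' := by
  obtain ⟨Pr, hPr⟩ := exists_toGeomPoints_eq_of_forall_smul_eq (W := (kubertTateFive (m : K) (n : K)).baseChange L) hfix
  rcases Pr with _ | ⟨x, y, h⟩
  · exact absurd (hPr.symm.trans (map_zero _)) hP0
  · exact ⟨x, y, h, _, by rw [← hPr]; exact Affine.Point.map_some _ h⟩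

omit hE [CharZero L] [CharZero K] in
/-- The Weierstrass equation of `E ⊗ L` in the Kubert–Tate shape. [cite: Kubert1976, Table 3 (N = 5)] -/
theorem equation_iff (x y : L) :
    ((kubertTateFive (m : K) (n : K)).baseChange L).toAffine.Equation x y ↔
      y ^ 2 + ((n : L) - m) * x * y - m * (n : L) ^ 2 * y = x ^ 3 - m * n * x ^ 2 := by
  rw [baseChange_eq, Affine.equation_iff]
  simp only [kubertTateFive]
  constructor <;> intro h <;> linear_combination h

include hP₁ h25 in
/-- **The local condition of `Sel^ψ(E'/K)` at `L`, read in `Lˣ/Lˣ⁵`.** Let `c : Γ_K → ker ψ` be a cocycle whose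
class dies in `H¹(L, E')` (`[c] ∈ ψ.selmerLocalKer L`) and `(α, a)` a Kummer generator of `c`. Then for some `k`
with `5 ∤ k`, `u ∈ Lˣ` and `5P₁ = (x₀, y₀)`: either `(ιa)ᵏ = u⁵` in `L`, or
`(ιa)ᵏ · u⁵ · ι f_T(x₀, y₀) = f_T(x, y)` for an `L`-rational affine point `(x, y) ≠ (0,0) = T` of `E`
(`f_T = xy − nx² + n²y`). [cite: SilvermanAEC2009, Prop. X.4.9 and Exercise 10.1(c)] [cite: Fisher2001FiveSevenDescent, §2] -/
theorem kummer_local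
    (c : letI := ψ.kerAction
      contOneCocycles (discreteTopRep (absoluteGaloisGroup K) ψ.toAddMonoidHom.ker))
    (hsel : letI := ψ.kerAction
      oneCocycleClass _ c ∈ ψ.selmerLocalKer L)
    {α : (AlgebraicClosure K)ˣ} {a : Kˣ}
    (hαp : α ^ 5 = Units.map (algebraMap K (AlgebraicClosure K) : K →* AlgebraicClosure K) a)
    (hcα : ∀ σ : absoluteGaloisGroup K, muVal K 5 (dualKerChar (fiveIsogeny (m : K) (n : K)) ψ hψ (Tbar (m : K) (n : K))
      (five_zsmul_Tbar (m : K) (n : K)) (ker_fiveIsogeny_eq_zmultiples (m : K) (n : K)) (c.1 σ)) = σ • α / α) :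
    ∃ (k : ℕ) (u x y : L) (x₀ y₀ : K), ¬ 5 ∣ k ∧ u ≠ 0 ∧
      ((algebraMap K L a) ^ k = u ^ 5 ∨
        ((y ^ 2 + ((n : L) - m) * x * y - m * (n : L) ^ 2 * y = x ^ 3 - m * n * x ^ 2 ∧ ¬ (x = 0 ∧ y = 0)) ∧
         (y₀ ^ 2 + ((n : K) - m) * x₀ * y₀ - m * (n : K) ^ 2 * y₀ = x₀ ^ 3 - m * n * x₀ ^ 2 ∧ ¬ (x₀ = 0 ∧ y₀ = 0)) ∧
          (algebraMap K L a) ^ k * u ^ 5 * algebraMap K L (x₀ * y₀ - n * x₀ ^ 2 + (n : K) ^ 2 * y₀) =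
            x * y - n * x ^ 2 + (n : L) ^ 2 * y)) := by
  letI := ψ.kerAction
  set φ := fiveIsogeny (m : K) (n : K) with hφdef
  set T₀ := Tbar (m : K) (n : K) with hT₀
  have hT : ((5 : ℕ) : ℤ) • T₀ = 0 := five_zsmul_Tbar (m : K) (n : K)
  have hT0 : T₀ ≠ 0 := Tbar_ne_zero (m : K) (n : K)
  have hTfix : ∀ σ : absoluteGaloisGroup K, σ • T₀ = T₀ := smul_Tbar (m : K) (n : K)
  have hker : φ.toAddMonoidHom.ker = AddSubgroup.zmultiples T₀ := ker_fiveIsogeny_eq_zmultiples (m : K) (n : K)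
  -- the base-changed isogenies
  obtain ⟨φL, hφL, -, hφLcard⟩ := Isogeny.exists_baseChange_field L φ
  obtain ⟨ψL, hψL, -, -⟩ := Isogeny.exists_baseChange_field L ψ
  letI := ψL.kerAction
  have hφL' : ∀ P : (kubertTateFive (m : K) (n : K)).geomPoints, φL (baseExt (kubertTateFive (m : K) (n : K)) L P) = baseExt (kubertTateFive' (m : K) (n : K)) L (φ P) := fun P ↦ hφL P
  have hψL' : ∀ Q : (kubertTateFive' (m : K) (n : K)).geomPoints, ψL (baseExt (kubertTateFive' (m : K) (n : K)) L Q) = baseExt (kubertTateFive (m : K) (n : K)) L (ψ Q) := fun Q ↦ hψL Q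
  have hφLcard' : Nat.card φL.toAddMonoidHom.ker = 5 := hφLcard.trans (natCard_ker_fiveIsogeny (m : K) (n : K))
  have hLp := comp_eq_zsmul_of_baseChange φ ψ hψ L φL ψL hφL' hψL'
  -- the Selmer condition at `L`: a coboundary `Q'`
  obtain ⟨Q', hQ'⟩ := exists_coboundary_of_mem_selmerLocalKer ψ L ψL hψL' c hsel
  -- `T_L = (0,0)` and the base point `Q₀ = ι_* P₁`, `5Q₀ = ι_* (x₀, y₀)`
  obtain ⟨hT00, eTL⟩ := baseExt_Tbar (K := K) m n L
  obtain ⟨x₀, y₀, h₀', e₅, hT₅, he₀⟩ := exists_five_zsmul_eq m n P₁ hP₁ h25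
  set Q₀ : geomPoints ((kubertTateFive (m : K) (n : K)).baseChange L) :=
    baseExt (kubertTateFive (m : K) (n : K)) L P₁ with hQ₀def
  have hQ₀fix : ∀ τ : absoluteGaloisGroup L, τ • Q₀ = Q₀ := fun τ ↦ by
    rw [hQ₀def, ← baseExt_smul, hP₁]
  have h5Q₀ : ((5 : ℕ) : ℤ) • Q₀ = baseExt (kubertTateFive (m : K) (n : K)) L (((5 : ℕ) : ℤ) • P₁) := by
    rw [hQ₀def, map_zsmul]
  have h25' : ∀ R : geomPoints (kubertTateFive (m : K) (n : K)), ((5 : ℕ) : ℤ) • R = 0 →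
      ((5 : ℕ) : ℤ) • P₁ ≠ R := by
    intro R hR hPR
    apply h25
    rw [show ((25 : ℕ) : ℤ) • P₁ = ((5 : ℕ) : ℤ) • (((5 : ℕ) : ℤ) • P₁) by rw [← mul_zsmul]; norm_num, hPR, hR]
  have hQ₀0 : ((5 : ℕ) : ℤ) • Q₀ ≠ 0 := by
    rw [h5Q₀, Ne, ← (baseExt _ L).map_zero, (baseExt_injective _ L).eq_iff]
    exact h25' 0 (zsmul_zero _)
  have hQ₀T : ((5 : ℕ) : ℤ) • Q₀ ≠ baseExt (kubertTateFive (m : K) (n : K)) L T₀ := by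
    rw [h5Q₀, Ne, (baseExt_injective _ L).eq_iff]
    exact h25' T₀ hT
  have hQ₀negT : ((5 : ℕ) : ℤ) • Q₀ ≠ -baseExt (kubertTateFive (m : K) (n : K)) L T₀ := by
    rw [h5Q₀, ← map_neg, Ne, (baseExt_injective _ L).eq_iff]
    exact h25' (-T₀) (by rw [zsmul_neg, hT, neg_zero])
  -- the Kummer function on `E_L` and its value at `5Q₀ = ι_*(x₀, y₀)`
  obtain ⟨fL, hfL0, hfLord, hfLval⟩ := exists_kummerFn (K := K) m n L hT00
  have hfLord' : ∀ Q : geomPoints ((kubertTateFive (m : K) (n : K)).baseChange L),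
      ord (((kubertTateFive (m : K) (n : K)).baseChange L).baseChange (AlgebraicClosure L)).toAffine Q fL =
        ((5 : ℕ) : ℤ) * ((if Q = baseExt (kubertTateFive (m : K) (n : K)) L T₀ then 1 else 0) -
          (if Q = 0 then 1 else 0)) := by
    intro Q; rw [hfLord Q, eTL]
  obtain ⟨h₀'', e₀⟩ := baseExt_some_algebraMap (K := K) m n L h₀'
  have ha₀ : ((kubertTateFive (m : K) (n : K)).baseChange L).HasValueAt fL (((5 : ℕ) : ℤ) • Q₀)
      (algebraMap L (AlgebraicClosure L) (algebraMap K L (x₀ * y₀ - n * x₀ ^ 2 + (n : K) ^ 2 * y₀))) := by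
    rw [h5Q₀, e₅, e₀]
    refine (hfLval _ _ h₀'').congr rfl ?_
    rw [← IsScalarTower.algebraMap_apply K L (AlgebraicClosure L)]
    simp only [map_sub, map_add, map_mul, map_pow, map_intCast]
  -- case `P = ψ_L Q' = O`
  by_cases hP0 : ψL Q' = 0
  · obtain ⟨k, u, hk, hu0, hu⟩ := exists_pow_eq_pow_of_psi_eq_zero φ ψ hψ T₀ hT hT0 hTfix hker L φL ψL
      hφL' hψL' hφLcard' c hQ' hP0 hαp hcα
    exact ⟨k, u, 0, 0, x₀, y₀, hk, hu0, Or.inl hu⟩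
  -- otherwise translate `Q'` by `X ∈ {O, φ_L Q₀}` so that `ψ_L(Q' + X) ∉ {O, T_L}`
  obtain ⟨X, hXfix, hP0', hPT'⟩ : ∃ X : geomPoints ((kubertTateFive' (m : K) (n : K)).baseChange L),
      (∀ τ : absoluteGaloisGroup L, τ • X = X) ∧ ψL (Q' + X) ≠ 0 ∧ ψL (Q' + X) ≠ baseExt (kubertTateFive (m : K) (n : K)) L T₀ := by
    by_cases hPT : ψL Q' = baseExt (kubertTateFive (m : K) (n : K)) L T₀
    · refine ⟨φL Q₀, fun τ ↦ by rw [← Isogeny.map_smul, hQ₀fix], ?_, ?_⟩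
      · rw [map_add, hLp, hPT]
        exact fun h0 ↦ hQ₀negT (eq_neg_of_add_eq_zero_right h0)
      · rw [map_add, hLp, hPT]
        exact fun h0 ↦ hQ₀0 (add_eq_left.mp h0)
    · exact ⟨0, fun τ ↦ smul_zero τ, by rwa [add_zero], by rwa [add_zero]⟩
  have hc' : ∀ τ : absoluteGaloisGroup L,
      (((Isogeny.resCocycle ψ L ψL hψL' c).1 τ : ψL.toAddMonoidHom.ker) : geomPoints ((kubertTateFive' (m : K) (n : K)).baseChange L)) =
        τ • (Q' + X) - (Q' + X) := fun τ ↦ by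
    rw [hQ' τ, smul_add, hXfix τ]; abel
  -- the point `P = ψ_L(Q' + X)` is `L`-rational: `P = (x, y)`
  have hPfix : ∀ τ : absoluteGaloisGroup L, τ • ψL (Q' + X) = ψL (Q' + X) :=
    smul_psi_eq_of_coboundary ψL (Isogeny.resCocycle ψ L ψL hψL' c) hc'
  obtain ⟨x, y, hxy, hxy', ePxy⟩ := exists_eq_some_of_fixed (K := K) m n L hPfix hP0'
  have hb : ((kubertTateFive (m : K) (n : K)).baseChange L).HasValueAt fL (ψL (Q' + X))
      (algebraMap L (AlgebraicClosure L) (x * y - n * x ^ 2 + (n : L) ^ 2 * y)) := by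
    rw [ePxy]
    refine (hfLval _ _ hxy').congr rfl ?_
    simp only [map_sub, map_add, map_mul, map_pow, map_intCast]
  -- the Kummer invariant is the descent value
  obtain ⟨k, u, hk, hu0, hu⟩ := exists_pow_mul_pow_eq_value_of_coboundary φ ψ hψ T₀ hT hT0 hTfix hker L φL ψL
    hφL' hψL' hφLcard' hfL0 hfLord' c hc' hP0' hPT' hb hQ₀0 hQ₀T hQ₀fix ha₀ hαp hcα
  refine ⟨k, u, x, y, x₀, y₀, hk, hu0, Or.inr ⟨⟨?_, ?_⟩, ⟨he₀, hT₅⟩, ?_⟩⟩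
  · exact (equation_iff (K := K) m n L x y).mp hxy.left
  · rintro ⟨rfl, rfl⟩
    apply hPT'
    rw [ePxy, eTL]
    exact some_eq_some_of_eq (map_zero _) (map_zero _) _ _
  · exact (algebraMap L (AlgebraicClosure L)).injective (by rw [map_mul]; exact hu)

end Local

end KubertTateMuDescentNF

end Literature.NumberTheory.EllipticCurves

end
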